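import Literature.Probability.RandomPlanarGeometry.SAWPatternDensity

/-!
# Line `kesten-product-renewal-dictionary` for the crux `SAWTotalPositivity.CriticalBubbleBound`
(stmt-CriticalPhenomena-7117): stub T2 `badBlocks_le` — few boundary steps force few wide blocks

The strip-gap programme of the line (the provable floor of its one-walk conjecture B1: the strict
inequality `μ(strip of width w) < μ(ℤ²)`, by induction on the width `w` with the block decomposition of
Madras–Slade Lemma 7.2.5, `Zd.card_few_badBlocks_le` of `SAWPatternDensity.lean`) needs the following
combinatorial input ("Case 2" of the induction step), proved here as `badBlocks_le`: for an `n`-step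
self-avoiding walk `ω` on `ℤ²` all of whose columns (first coordinates) up to time `n` lie in the window
`[R - (w + 1), R]`, the number of blocks of length `M ≥ 1` whose subwalk is **not** `w`-narrow
(`x`-extent `≥ w + 1`) is at most `2k + 4`, where `k` is the number of steps of `ω` inside the column `R`
(times `t < n` with `ω t 0 = ω (t + 1) 0 = R`).

Proof. A block that is not `w`-narrow visits both the column `R` and the column `R - (w + 1) ≠ R`, so
it contains a *transition step* `u → u + 1` with exactly one endpoint in column `R`
(`exists_transition_of_mem_badBlocks`, by the discrete intermediate value principle
`exists_step_of_not_iff`); distinct blocks have disjoint step ranges, so the bad blocks inject into the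
transition steps. A transition step is an entry into or an exit from column `R`; since `R` bounds all
columns, an entry ending at a time `< n` is followed by a step inside column `R` (otherwise
`ω u = ω (u + 2)`, `col_eq_of_col_ne`), and an exit starting at a time `≥ 1` is preceded by one, whence
`#transitions ≤ 2k + 2` (`card_transitions_le`).

Source of the block decomposition: N. Madras, G. Slade, *The Self-Avoiding Walk* (1993), Lemma 7.2.5.
-/

noncomputable section

open Literature.Probability.LatticeModels
open Literature.Probability.RandomPlanarGeometry Literature.Probability.RandomPlanarGeometry.SAW
open scoped ENNReal NNReal BigOperators

namespace Summit.CriticalPhenomena.SAWScalingLimit.Theorems.CriticalBubbleBound.Kesten.Strip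

/-! ## The discrete intermediate value principle -/

/-- **Discrete intermediate value principle**: if a property holds at exactly one of two times
`a ≤ c`, then it changes along some step `u → u + 1` with `a ≤ u < c`. [folklore] -/
theorem exists_step_of_not_iff {P : ℕ → Prop} (a : ℕ) :
    ∀ c : ℕ, a ≤ c → ¬ (P a ↔ P c) → ∃ u, a ≤ u ∧ u < c ∧ ¬ (P u ↔ P (u + 1)) := by
  intro c
  induction c with
  | zero =>
    intro ha h
    obtain rfl : a = 0 := Nat.le_zero.1 ha
    exact absurd Iff.rfl h
  | succ c ih =>
    intro ha h
    rcases Nat.lt_or_ge a (c + 1) with hlt | hge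
    · by_cases hc : (P c ↔ P (c + 1))
      · obtain ⟨u, hu, huc, hP⟩ := ih (Nat.le_of_lt_succ hlt) fun h' => h (h'.trans hc)
        exact ⟨u, hu, Nat.lt_succ_of_lt huc, hP⟩
      · exact ⟨c, Nat.le_of_lt_succ hlt, Nat.lt_succ_self c, hc⟩
    · obtain rfl : a = c + 1 := le_antisymm ha hge
      exact absurd Iff.rfl h

/-- The discrete intermediate value principle for two times of a window `[lo, hi]`, in either
order: the property changes along a step of the window. [folklore] -/
theorem exists_step_of_not_iff' {P : ℕ → Prop} {lo hi a c : ℕ} (ha : lo ≤ a) (ha' : a ≤ hi)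
    (hc : lo ≤ c) (hc' : c ≤ hi) (h : ¬ (P a ↔ P c)) :
    ∃ u, lo ≤ u ∧ u < hi ∧ ¬ (P u ↔ P (u + 1)) := by
  rcases le_total a c with hac | hca
  · obtain ⟨u, hu, hu', hP⟩ := exists_step_of_not_iff a c hac h
    exact ⟨u, by omega, by omega, hP⟩
  · obtain ⟨u, hu, hu', hP⟩ := exists_step_of_not_iff c a hca fun h' => h h'.symm
    exact ⟨u, by omega, by omega, hP⟩

/-! ## Plane geometry at the right wall -/

/-- A nearest-neighbour step of `ℤ²` in coordinates: it is `±e₀` or `±e₁`. [folklore] -/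
theorem adj_coord {x y : Site 2} (h : (zdGraph 2).Adj x y) :
    ((y 0 = x 0 + 1 ∧ y 1 = x 1) ∨ (x 0 = y 0 + 1 ∧ x 1 = y 1)) ∨
      ((y 0 = x 0 ∧ y 1 = x 1 + 1) ∨ (x 0 = y 0 ∧ x 1 = y 1 + 1)) := by
  rw [zdGraph_adj_iff, Fin.exists_fin_two] at h
  simpa only [funext_iff, Fin.forall_fin_two, Pi.add_apply, Pi.single_eq_same,
    Pi.single_eq_of_ne (one_ne_zero : (1 : Fin 2) ≠ 0),
    Pi.single_eq_of_ne (zero_ne_one : (0 : Fin 2) ≠ 1), add_zero] using h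

/-- **No U-turn at the right wall.** If all columns of the self-avoiding walk `ω` up to time `n` are
`≤ R` and `ω` is in column `R` at time `v + 1` (with `v + 2 ≤ n`) but not at time `v`, then it is in
column `R` at time `v + 2`: otherwise `ω v = ω (v + 1) - e₀ = ω (v + 2)`. [folklore] -/
theorem col_eq_of_col_ne {n : ℕ} {R : ℤ} {ω : ℕ → Site 2} (hω : ω ∈ Zd.saws 2 n)
    (hle : ∀ i ≤ n, ω i 0 ≤ R) {v : ℕ} (hv : v + 2 ≤ n) (h1 : ω (v + 1) 0 = R) (h0 : ¬ ω v 0 = R) :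
    ω (v + 2) 0 = R := by
  obtain ⟨-, -, hadj, hinj⟩ := Zd.mem_saws.1 hω
  by_contra h2
  have ha := adj_coord (hadj v (by omega))
  have hb := adj_coord (show (zdGraph 2).Adj (ω (v + 1)) (ω (v + 2)) from hadj (v + 1) (by omega))
  have hv0 := hle v (by omega)
  have hv2 := hle (v + 2) hv
  have he : ω v = ω (v + 2) := by
    refine funext (Fin.forall_fin_two.2 ⟨?_, ?_⟩) <;> omega
  have h3 : v = v + 2 := hinj (show v ≤ n by omega) (show v + 2 ≤ n from hv) he
  omega

/-! ## Bad blocks contain transition steps -/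

/-- **A bad block carries an occurrence**: if the `b`-th block of length `M` of the self-avoiding
walk `ω` is bad for the event family `X`, then `X` occurs at some step of the block's subwalk.
[folklore] -/
theorem exists_of_mem_badBlocks {X : ℕ → (ℕ → Site 2) → ℕ → Prop} {n M : ℕ} {ω : ℕ → Site 2}
    (hω : ω ∈ Zd.saws 2 n) {b : Fin (n / M)} (hb : b ∈ Zd.badBlocks X M n ω) :
    ∃ j, j ≤ M ∧ X M (Zd.subwalk ω (b * M) M) j := by
  classical
  unfold Zd.badBlocks Zd.goodWalks at hb
  rw [Finset.mem_filter, Finset.mem_filter, not_and] at hb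
  have := hb.2 (Zd.subwalk_mem hω (Zd.block_le b))
  push Not at this
  exact this

/-- **A block that is not `w`-narrow contains a transition step at the wall.** If all columns of
`ω ∈ saws 2 n` up to time `n` lie in `[R - (w + 1), R]` and the `b`-th block of length `M` of `ω` is bad
for the event "not `w`-narrow", then some step `u → u + 1` of the block has exactly one endpoint in
column `R` (the block visits column `R` and column `R - (w + 1)`). [folklore] -/
theorem exists_transition_of_mem_badBlocks {w n M : ℕ} {R : ℤ} {ω : ℕ → Site 2}
    (hω : ω ∈ Zd.saws 2 n) (hle : ∀ i ≤ n, ω i 0 ≤ R) (hge : ∀ i ≤ n, R ≤ ω i 0 + ((w : ℤ) + 1))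
    {b : Fin (n / M)}
    (hb : b ∈ Zd.badBlocks (fun (M' : ℕ) (β : ℕ → Site 2) (_ : ℕ) =>
      ¬ ∀ i ≤ M', ∀ i' ≤ M', β i 0 ≤ β i' 0 + (w : ℤ)) M n ω) :
    ∃ u, (b : ℕ) * M ≤ u ∧ u < b * M + M ∧ ¬ (ω u 0 = R ↔ ω (u + 1) 0 = R) := by
  have hbM : (b : ℕ) * M + M ≤ n := Zd.block_le b
  obtain ⟨j, -, hj⟩ := exists_of_mem_badBlocks hω hb
  have key : ¬ ∀ i ≤ M, ∀ i' ≤ M,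
      Zd.subwalk ω (b * M) M i 0 ≤ Zd.subwalk ω (b * M) M i' 0 + (w : ℤ) := hj
  push Not at key
  obtain ⟨i, hi, i', hi', hlt⟩ := key
  rw [Zd.subwalk_apply hi, Zd.subwalk_apply hi'] at hlt
  simp only [Pi.add_apply, Pi.neg_apply] at hlt
  have h1 := hle (b * M + i) (by omega)
  have h2 := hge (b * M + i') (by omega)
  have hR : ω (b * M + i) 0 = R := by omega
  have hR' : ¬ ω (b * M + i') 0 = R := by omega
  exact exists_step_of_not_iff' (P := fun u => ω u 0 = R) (lo := b * M) (hi := b * M + M)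
    (a := b * M + i) (c := b * M + i') (by omega) (by omega) (by omega) (by omega)
    (fun h => hR' (h.1 hR))

/-! ## Counting transition steps -/

/-- **Transition steps at the wall versus steps inside the wall.** If all columns of `ω ∈ saws 2 n`
up to time `n` are `≤ R`, the number of steps with exactly one endpoint in column `R` is at most
`2k + 2`, where `k` is the number of steps inside column `R`: an entry into column `R` ending at a time
`< n` is followed by a step inside column `R`, and an exit starting at a time `≥ 1` is preceded by one
(`col_eq_of_col_ne`), injectively. [folklore] -/
theorem card_transitions_le {n : ℕ} {R : ℤ} {ω : ℕ → Site 2} (hω : ω ∈ Zd.saws 2 n)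
    (hle : ∀ i ≤ n, ω i 0 ≤ R) :
    ((Finset.range n).filter fun u => ¬ (ω u 0 = R ↔ ω (u + 1) 0 = R)).card ≤
      2 * ((Finset.range n).filter fun t => ω t 0 = R ∧ ω (t + 1) 0 = R).card + 2 := by
  set K := (Finset.range n).filter fun t => ω t 0 = R ∧ ω (t + 1) 0 = R with hK
  set E := (Finset.range n).filter fun u => ¬ ω u 0 = R ∧ ω (u + 1) 0 = R with hE
  set X := (Finset.range n).filter fun u => ω u 0 = R ∧ ¬ ω (u + 1) 0 = R with hX
  have hsub : ((Finset.range n).filter fun u => ¬ (ω u 0 = R ↔ ω (u + 1) 0 = R)) ⊆ E ∪ X := by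
    intro u hu
    rw [Finset.mem_filter] at hu
    rw [Finset.mem_union, hE, hX, Finset.mem_filter, Finset.mem_filter]
    by_cases h : ω u 0 = R
    · exact Or.inr ⟨hu.1, h, fun h' => hu.2 (iff_of_true h h')⟩
    · refine Or.inl ⟨hu.1, h, ?_⟩
      by_contra h'
      exact hu.2 (iff_of_false h h')
  -- entries, shifted by one, are steps inside the wall (or the last step)
  have hEc : E.card ≤ K.card + 1 := by
    calc E.card ≤ (insert n K).card := by
          refine Finset.card_le_card_of_injOn (fun u => u + 1) (fun u hu => ?_) (fun u _ u' _ h => ?_)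
          · rw [Finset.mem_coe, hE, Finset.mem_filter, Finset.mem_range] at hu
            obtain ⟨hun, hu0, hu1⟩ := hu
            show u + 1 ∈ insert n K
            rw [Finset.mem_insert]
            rcases Nat.lt_or_ge (u + 1) n with h | h
            · right
              rw [hK, Finset.mem_filter, Finset.mem_range]
              exact ⟨h, hu1, col_eq_of_col_ne hω hle (v := u) h hu1 hu0⟩
            · left
              omega
          · simpa using h
      _ ≤ K.card + 1 := Finset.card_insert_le _ _
  -- exits, shifted back by one, are steps inside the wall (or the first step)
  have hXc : X.card ≤ K.card + 1 := by
    calc X.card ≤ (insert 0 (K.image fun t => t + 1)).card := by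
          refine Finset.card_le_card fun u hu => ?_
          rw [hX, Finset.mem_filter, Finset.mem_range] at hu
          obtain ⟨hun, hu0, hu1⟩ := hu
          rw [Finset.mem_insert, Finset.mem_image]
          rcases Nat.eq_zero_or_pos u with h | h
          · exact Or.inl h
          · obtain ⟨v, rfl⟩ : ∃ v, u = v + 1 := ⟨u - 1, by omega⟩
            refine Or.inr ⟨v, ?_, rfl⟩
            rw [hK, Finset.mem_filter, Finset.mem_range]
            refine ⟨by omega, ?_, hu0⟩
            by_contra hv0
            exact hu1 (col_eq_of_col_ne hω hle (v := v) hun hu0 hv0)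
      _ ≤ (K.image fun t => t + 1).card + 1 := Finset.card_insert_le _ _
      _ ≤ K.card + 1 := Nat.add_le_add_right Finset.card_image_le 1
  calc ((Finset.range n).filter fun u => ¬ (ω u 0 = R ↔ ω (u + 1) 0 = R)).card
      ≤ (E ∪ X).card := Finset.card_le_card hsub
    _ ≤ E.card + X.card := Finset.card_union_le _ _
    _ ≤ 2 * K.card + 2 := by omega

/-! ## The stub -/

/-- **Few boundary steps force few wide blocks** (strip-gap programme, T2). For an `n`-step
self-avoiding walk `ω` on `ℤ²` whose columns up to time `n` all lie in `[R - (w + 1), R]`, the number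
of blocks of length `M ≥ 1` whose subwalk is not `w`-narrow is at most `2k + 4`, where `k` is the
number of steps of `ω` inside the column `R`: each such block contains a transition step at the wall
(`exists_transition_of_mem_badBlocks`), distinct blocks contain distinct steps, and there are at most
`2k + 2` transition steps (`card_transitions_le`). [folklore] -/
theorem badBlocks_le : ∀ (w n M : ℕ) (R : ℤ) (ω : ℕ → Site 2), 1 ≤ M → ω ∈ Zd.saws 2 n → (∀ i ≤ n, ω i 0 ≤ R) → (∀ i ≤ n, R ≤ ω i 0 + ((w : ℤ) + 1)) → (Zd.badBlocks (fun (M' : ℕ) (β : ℕ → Site 2) (_ : ℕ) => ¬ ∀ i ≤ M', ∀ i' ≤ M', β i 0 ≤ β i' 0 + (w : ℤ)) M n ω).card ≤ 2 * ((Finset.range n).filter (fun t => ω t 0 = R ∧ ω (t + 1) 0 = R)).card + 4 := by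
  intro w n M R ω _hM hω hle hge
  have hex : ∀ b ∈ Zd.badBlocks (fun (M' : ℕ) (β : ℕ → Site 2) (_ : ℕ) =>
      ¬ ∀ i ≤ M', ∀ i' ≤ M', β i 0 ≤ β i' 0 + (w : ℤ)) M n ω,
      ∃ u, (b : ℕ) * M ≤ u ∧ u < b * M + M ∧ ¬ (ω u 0 = R ↔ ω (u + 1) 0 = R) :=
    fun b hb => exists_transition_of_mem_badBlocks hω hle hge hb
  choose! f hf using hex
  have h1 : (Zd.badBlocks (fun (M' : ℕ) (β : ℕ → Site 2) (_ : ℕ) =>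
      ¬ ∀ i ≤ M', ∀ i' ≤ M', β i 0 ≤ β i' 0 + (w : ℤ)) M n ω).card ≤
      ((Finset.range n).filter fun u => ¬ (ω u 0 = R ↔ ω (u + 1) 0 = R)).card := by
    refine Finset.card_le_card_of_injOn f (fun b hb => ?_) (fun b hb b' hb' h => ?_)
    · obtain ⟨-, hb2, hb3⟩ := hf b (Finset.mem_coe.1 hb)
      have := Zd.block_le b
      rw [Finset.mem_coe, Finset.mem_filter, Finset.mem_range]
      exact ⟨by omega, hb3⟩
    · obtain ⟨hb1, hb2, -⟩ := hf b (Finset.mem_coe.1 hb)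
      obtain ⟨hb1', hb2', -⟩ := hf b' (Finset.mem_coe.1 hb')
      have e : f b / M = b := Nat.div_eq_of_lt_le hb1 (by rw [Nat.add_one_mul]; exact hb2)
      have e' : f b' / M = b' := Nat.div_eq_of_lt_le hb1' (by rw [Nat.add_one_mul]; exact hb2')
      exact Fin.ext (by rw [← e, ← e', h])
  have h2 := card_transitions_le hω hle
  omega

end Summit.CriticalPhenomena.SAWScalingLimit.Theorems.CriticalBubbleBound.Kesten.Strip

end
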